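import Mathlib
import Literature.MathematicalPhysics.QuantumFieldTheory.Luscher2010.TrivializingMaps
import Summits.Ventures.LatticeQCDFlow.TrivializingMaps.LuscherSeriesExistence
import Summits.Ventures.LatticeQCDFlow.TrivializingMaps.SeriesUniqueness
import Summits.Ventures.LatticeQCDFlow.TrivializingMaps.MassTransferContraction
import HarnessLib

/-!
# The local mode norm: what a formal proof of THEOREM A for `SU(n)` has to supply, and what it buys
# (THEORY-1 §12.2 (F1)–(F5) as ONE typed obligation; §12.3–12.4 kernel-checked on top of it)

HONEST FRAMING: exact (Metropolis-corrected) sampling algorithms for lattice gauge theory; figures of merit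
are autocorrelation/cost numbers at stated couplings and volumes; no continuum-physics claim.

Proposed tree file: `Summits/Ventures/LatticeQCDFlow/TrivializingMaps/LocalModeNorm.lean` (venture side;
namespace `Summit.Ventures.LatticeQCDFlow.TrivializingMaps`). One `@[conjecture]` obligation
(`HasLocalModeNorm`, OURS, NOT asserted, never a Literature fact) and theorems; no `sorry`, no new axioms.

## The split of THEOREM A (THEORY-1 §12) into a textbook half and a kernel-checked half

THEOREM A (`LuscherGeometricGradientBound d n`, `Truncation.lean` §6, `@[conjecture]`; proved on paper in
THEORY-1 §12, second-seat reviewed) says: the link gradients of Lüscher's perturbative flow action for the Wilson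
plaquette action are bounded GEOMETRICALLY, `|∂^a_e S̃^{(k)}(U)| ≤ C ρ^{-k}`, with `ρ, C` INDEPENDENT OF THE
LATTICE SIZE. By `TheoremAReduction.lean` it suffices to bound the ONE constructed series
`wilsonSk d L B₀ k` (`LuscherSeriesExistence.lean`) in ONE basis `B₀`. The paper proof has two halves:

* (TEXTBOOK HALF, THEORY-1 §12.2 (F1)–(F5) + §12.3 steps (0)–(1)) harmonic analysis on the compact group
  `SU(n)^E`: Peter–Weyl, `Δ` diagonal with Casimir eigenvalues `c(π) = ∑_e c(λ_e)`, `∂^a_e` preserving the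
  isotypic components with `‖·‖` cost `ω(λ_e) ≤ w(λ_e) := √c(λ_e)`, the Fourier algebra norm
  `‖f‖_A = ∑_π d_π ‖f̂(π)‖₁` being submultiplicative [Edwards 1972, (2.9.10)–(2.9.11); Kaniuth 2009, Thm 2.9.2],
  the finite shift constant `σ_F`, and the support lemma (girth). OUTPUT of this half, and the ONLY thing the
  rest of the proof uses: for every lattice size `L`, MODE DATA in the sense of `MassTransferContraction.lean`
  — link weights, Casimirs, per-order mass profiles `ν_k` (`ν_k(π) = d_π ‖ŝ_k(π)‖₁`) and per-step transfer
  amounts obeying (T1)–(T3), (G) — whose link masses DOMINATE the link gradients,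
  `|∂_{e,T_a} S̃_W^{(k)}(ιU)| ≤ N_e(ν_k)`, with the five constants `D, Γ, κ, σ, γ` and the initial mass `N₀`
  BOUNDED UNIFORMLY IN `L`. This is `HasLocalModeNorm d n B₀` below: a `Prop`, tagged `@[conjecture]`
  (an obligation node of ours), whose witnesses for `SU(n)` are classical but need Peter–Weyl / Schur
  orthogonality on compact Lie groups, absent from Mathlib (FANOUT-theory1 R-T1-10b/c: library-scale).
  Its `U(1)` analogue — integer link vectors, `w = |m_e|`, `c = ∑ m_e²`, `κ = σ = Γ = 1` — needs no
  representation theory and IS kernel-checked in the tree (`Abelian*.lean`).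
* (OUR HALF, THEORY-1 §12.3 (2) + Parts A/B + §12.4) the one-step contraction `N(ν_{k+1}) ≤ θ₀ N(ν_k)`,
  `θ₀ = DΓ(1/κ + 8σ/γ)`, and the geometric iteration — kernel-checked in `MassTransferContraction.lean`
  (`MassTransfer.linkMass_le`, `MassTransfer.linkMass_iterate_le_of_le`), and assembled HERE:
  `fixedBasisGradientBound_of_hasLocalModeNorm : HasLocalModeNorm d n B₀ →` (the fixed-basis form of
  Theorem A, = the right-hand side of `luscherGeometricGradientBound_iff_fixedBasis`), with
  `ρ = 1 / max θ 1` and `C = N₀`. The last step `→ LuscherGeometricGradientBound d n` is the `.mpr` of that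
  `iff` (`LocalModeNormTheoremA.lean`, after `TheoremAReduction.lean` lands).

So after this file THEOREM A is kernel-checked FROM `HasLocalModeNorm d n B₀` for one basis `B₀`. CAUTION
(theory-1 GEN-9, `LocalModeNormEquivalence.lean`): as a `Prop`, `HasLocalModeNorm d n B₀` is EQUIVALENT to
THEOREM A — the one-mode bookkeeping (one mode of weight `1` on every link, masses `max C 0 · ρ^{-k}`) inhabits
`LocalModeNormData` as soon as the gradients are geometrically bounded, because (T1)–(T3), (G) constrain the
bookkeeping only relative to the masses one declares. So it is an INTERFACE through which every proof of
THEOREM A factors (completeness) and which has the shape of the intended Peter–Weyl proof, NOT a weaker or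
purely harmonic-analytic hypothesis: the open formal node remains THEOREM A itself, and "proved modulo
`HasLocalModeNorm`" carries no reduction of difficulty. Dictionary for the intended `SU(n)` witness (THEORY-1 §12.2–12.4, for the
normalised series `s_k`; the tree's `wilsonSk` may differ by an overall sign/normalisation convention, absorbed
in `ν`): modes `M` = assignments `π = (λ_e)_e` of irreducible representations to links (finitely many occur at
each order), `w π e = √c(λ_e)`, `c π = ∑_e c(λ_e)`, `κ = √c_min` (`c_min = C_F = (n²-1)/(2n)`),
`σ = σ_F` (`= √C_F` for `n = 2, 3`), `Γ = max_{p, e' ∈ p} ∑_a ‖∂^a_{e'} s_p‖_A ≤ (n²-1)n³/√2`, `γ = g·c_min`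
(`g = 1` for all `L`; `g = 4` for `L ≥ 4` by the support lemma), `D = 2(d-1)` (`L ≥ 2`; for `L = 1` links
repeat inside a plaquette and the witness must be built with `F ⊗ F̄` on repeated links — one fixed
finite-dimensional case, THEORY-1 §12.5), `N₀ ≤ D n³/(4√C_F)`; numbers: `SU(3)`, `d = 4`: `θ₀ ≤ 2.4×10³`.
Nothing in this docstring is asserted by the file.
-/

namespace Summit.Ventures.LatticeQCDFlow.TrivializingMaps

open Literature.MathematicalPhysics.QuantumFieldTheory
open Literature.MathematicalPhysics.QuantumFieldTheory.Luscher2010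
open MassTransfer
open scoped Matrix Matrix.Norms.Frobenius ContDiff

noncomputable section

/-! ## §1. Local mode norm data at one lattice size -/

/-- LOCAL MODE NORM DATA for the constructed Wilson-action Lüscher series `wilsonSk d L B₀` at lattice size
`L`, with rate bound `θ` and initial mass `N₀`: a link complex on the torus links, mode weights, per-order mass
profiles `μ k` on finite mode sets `S k`, per-step transfer amounts making every step `k → k+1` a transfer step
with constants `(σ, γ, Γ)`, the rate inequality `D·Γ·(1/κ + 8σ/γ) ≤ θ`, the initial bound `N_e(μ 0) ≤ N₀`, and
DOMINATION of the link gradients on the field manifold: `|∂_{e,T_a} S̃_W^{(k)}(ιU)| ≤ N_e(μ k)`.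
(THEORY-1 §12.2: for `SU(n)` this is Peter–Weyl bookkeeping; see the module docstring for the dictionary.)
[ours] -/
structure LocalModeNormData (d n : ℕ) (B₀ : SuBasis n) (θ N₀ : ℝ) (L : ℕ) [NeZero L] : Type 1 where
  /-- the mode index type -/
  M : Type
  /-- the plaquette (interaction term) index type -/
  P : Type
  /-- incidence: finitely many plaquettes, links of each (`≤ 4`), `≤ D` plaquettes through a link -/
  K : LinkComplex (Edge d L) P
  /-- link weights and Casimirs of the modes -/
  W : ModeWeights (Edge d L) M
  /-- shift constant, gap, vertex constant -/
  σ : ℝ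
  γ : ℝ
  Γ : ℝ
  /-- the modes occurring at order `k` -/
  S : ℕ → Finset M
  /-- the mass profile of `S̃_W^{(k)}` -/
  μ : ℕ → M → ℝ
  /-- the transfer amounts of the step `k → k + 1` -/
  T : ℕ → P → Edge d L → M → M → ℝ
  step : ∀ k, IsTransferStep K W σ γ Γ (S k) (S (k + 1)) (μ k) (μ (k + 1)) (T k)
  rate_le : (K.D : ℝ) * Γ * (1 / W.κ + 8 * σ / γ) ≤ θ
  init_le : ∀ e, W.linkMass (S 0) (μ 0) e ≤ N₀
  dominates : ∀ (k : ℕ) (U : GaugeConfig d L (Matrix.specialUnitaryGroup (Fin n) ℂ)) (e : Edge d L)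
    (a : B₀.ι), |linkDeriv e (B₀.T a) (wilsonSk d L B₀ k) (WilsonFlow.coeConfig U)| ≤ W.linkMass (S k) (μ k) e

namespace LocalModeNormData

variable {d n L : ℕ} [NeZero L] {B₀ : SuBasis n} {θ N₀ : ℝ}

/-- At one lattice size the data give the geometric bound `|∂_{e,T_a} S̃_W^{(k)}(ιU)| ≤ N₀ · (max θ 1)^k`
(contraction + iteration of `MassTransferContraction.lean`; PROVED). [ours] -/
theorem abs_linkDeriv_wilsonSk_le (X : LocalModeNormData d n B₀ θ N₀ L) (k : ℕ)
    (U : GaugeConfig d L (Matrix.specialUnitaryGroup (Fin n) ℂ)) (e : Edge d L) (a : B₀.ι) :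
    |linkDeriv e (B₀.T a) (wilsonSk d L B₀ k) (WilsonFlow.coeConfig U)| ≤ N₀ * ((max θ 1)⁻¹)⁻¹ ^ k :=
  (X.dominates k U e a).trans
    (linkMass_iterate_le_of_le X.step X.init_le (X.rate_le.trans (le_max_left θ 1)) k e)

/-- The initial mass, hence `N₀`, is nonnegative. [ours] -/
theorem N₀_nonneg (X : LocalModeNormData d n B₀ θ N₀ L) (e : Edge d L) : 0 ≤ N₀ :=
  (X.W.linkMass_nonneg (X.step 0).ν_nonneg e).trans (X.init_le e)

end LocalModeNormData

/-! ## §2. The obligation and the kernel-checked half of THEOREM A -/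

/-- **The local mode norm obligation (THEORY-1 §12.2 (F1)–(F5); OURS, an obligation node, NOT asserted and
NOT a Literature fact).** For the fixed orthonormal basis `B₀` of `𝔰𝔲(n)`: there are `θ` and `N₀` such that
for EVERY lattice size `L` the constructed Wilson-action Lüscher series admits local mode norm data with rate
bound `θ` and initial mass `N₀` (`LocalModeNormData`). Paper status: a theorem for every `d` and `n` by
Peter–Weyl on `SU(n)^E` (THEORY-1 §12.2–12.4, second-seat reviewed); formal status: OPEN — as a `Prop` it
is EQUIVALENT to `LuscherGeometricGradientBound d n` (`LocalModeNormEquivalence.lean`: trivial one-mode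
inhabitant), the intended witnesses need harmonic analysis on compact Lie groups not in Mathlib; the `U(1)`
analogue of the intended witness is kernel-checked (`Abelian*.lean`). [ours] -/
@[conjecture]
def HasLocalModeNorm (d n : ℕ) (B₀ : SuBasis n) : Prop :=
  ∃ θ N₀ : ℝ, ∀ (L : ℕ) [NeZero L], Nonempty (LocalModeNormData d n B₀ θ N₀ L)

/-- **THEOREM A from the local mode norm, fixed-basis form (ours; PROVED).** `HasLocalModeNorm d n B₀`
implies the volume-uniform geometric gradient bound for the constructed series in the basis `B₀` — literally
the right-hand side of `luscherGeometricGradientBound_iff_fixedBasis d n B₀` (`TheoremAReduction.lean`) —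
with `ρ = (max θ 1)⁻¹` and `C = N₀`. The volume never enters: `θ` and `N₀` are the same for all `L`.
[ours] -/
theorem fixedBasisGradientBound_of_hasLocalModeNorm {d n : ℕ} {B₀ : SuBasis n}
    (h : HasLocalModeNorm d n B₀) :
    ∃ ρ : ℝ, 0 < ρ ∧ ∃ C : ℝ, ∀ (L : ℕ) [NeZero L] (k : ℕ)
      (U : GaugeConfig d L (Matrix.specialUnitaryGroup (Fin n) ℂ)) (e : Edge d L) (a : B₀.ι),
      |linkDeriv e (B₀.T a) (wilsonSk d L B₀ k) (WilsonFlow.coeConfig U)| ≤ C * ρ⁻¹ ^ k := by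
  obtain ⟨θ, N₀, hX⟩ := h
  refine ⟨(max θ 1)⁻¹, inv_pos.mpr (lt_max_of_lt_right one_pos), N₀, fun L _ k U e a => ?_⟩
  obtain ⟨X⟩ := hX L
  exact X.abs_linkDeriv_wilsonSk_le k U e a

/-- The same bound for EVERY smooth Lüscher series of the Wilson action in the basis `B₀` (all of them have
the gradients of `wilsonSk d L B₀` on the field manifold, `SeriesUniqueness.lean`): the `B = B₀` instance of
`LuscherGeometricGradientBound d n` (ours; PROVED). The passage to an arbitrary basis `B` is
`luscherGeometricGradientBound_iff_fixedBasis` (`TheoremAReduction.lean`). [ours] -/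
theorem seriesGradientBound_of_hasLocalModeNorm {d n : ℕ} {B₀ : SuBasis n}
    (h : HasLocalModeNorm d n B₀) :
    ∃ ρ : ℝ, 0 < ρ ∧ ∃ C : ℝ, ∀ (L : ℕ) [NeZero L] (Sk : ℕ → AmbConfig d L n → ℝ) (c : ℕ → ℝ),
      (∀ k, ContDiff ℝ (⊤ : ℕ∞) (Sk k)) → IsLuscherSeries B₀ ambWilsonAction Sk c →
      ∀ (k : ℕ) (U : GaugeConfig d L (Matrix.specialUnitaryGroup (Fin n) ℂ)) (e : Edge d L) (a : B₀.ι),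
      |linkDeriv e (B₀.T a) (Sk k) (WilsonFlow.coeConfig U)| ≤ C * ρ⁻¹ ^ k := by
  obtain ⟨ρ, hρ, C, hC⟩ := fixedBasisGradientBound_of_hasLocalModeNorm h
  refine ⟨ρ, hρ, C, fun L _ Sk c hsm hser k U e a => ?_⟩
  rw [(IsLuscherSeries.linkDeriv_eq hser (isLuscherSeries_wilsonSk B₀) hsm
    (fun j => contDiff_wilsonSk B₀ j) k).2 e a U]
  exact hC L k U e a

end

end Summit.Ventures.LatticeQCDFlow.TrivializingMaps
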